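import Literature.Topology.FourManifolds.WeaklyReducibleTrisections
import Literature.Topology.FourManifolds.ImmersionCriterion

/-!
# Crux `WeakReductionDescent.DependentTripleGenusThreeStandard` (stmt-SmoothPoincare4-18000), line
# `Sketch`: every round circle of an annular chart of the central surface is a curve

Helper file (`--supports stmt-SmoothPoincare4-18000`).  Skeleton v5+ of
`Cruxes/DependentTripleGenusThreeStandard/Lines/Sketch.lean` tells Aranda–Zupan's configurations
(1)/(2) (arXiv:2503.04607 §7 p. 24) apart by an inline ANNULAR CHART of the central surface
`F = centralSurfaceSet T`: a plane map `ψ : ℝ² → M` which, on an open round annulus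
`{rlo < ‖x‖ < rhi}`, is smooth, injective and immersive into `M` with image in `F`; the two
curves are its round circles of radii `r₀`, `r₁` (consumers: `stub_boundsDisc_of_annularChart`,
p168238; `stub_separatingPairWeaklyReducible_of_noAnnularChart01`).  This file records that EVERY
round circle `ψ(r · S¹)`, `rlo < r < rhi`, `0 < r`, of such a chart is a curve of `F`
(`Trisection.IsCurve T`): it lies in `F` and `x ↦ ψ (r • x)` is a smooth embedding `S¹ → M`
(an injective immersion of the compact circle — the surface version is
`SurfaceCircleSweep.isSmoothEmbedding_comp_smul_sphere_of_annulus`, whose proof is repeated with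
target `M`).  So intermediate circles of a chart between `f i` and `f j` are again available as
curves (e.g. to shrink an annulus away from a third curve).  No definition, no named fact.
-/

-- the registered namespace `Summit.SmoothPoincare4.SmoothPoincare4.Theorems…` repeats a component
set_option linter.dupNamespace false

noncomputable section

open scoped Manifold ContDiff Topology
open Set Function Metric Module
open Literature.Topology.FourManifolds
open Literature.Topology.FourManifolds.Trisection

namespace Summit.SmoothPoincare4.SmoothPoincare4.Theorems

/-- **A round circle of an annular chart into a 4-manifold is a smoothly embedded circle**: if
`ψ : ℝ² → M` is smooth and injective on the open annulus `{r_lo < ‖x‖ < r_hi}` with injective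
differential there (as a map into the 4-manifold `M`), then for `r_lo < c < r_hi`, `0 < c`, the
circle `x ↦ ψ (c • x)` is a smooth embedding `S¹ → M` (Hirsch, Ch. 1 §3 Thm. 3.1: an injective
immersion of a compact manifold is an embedding). [cite: HirschDT1976, Ch. 1 §3 Thm. 3.1] -/
theorem isSmoothEmbedding_comp_smul_sphere_of_annularChart
    {M : Type} [TopologicalSpace M] [T2Space M] [ChartedSpace (EuclideanSpace ℝ (Fin 4)) M]
    [IsManifold (𝓡 4) ∞ M] {ψ : EuclideanSpace ℝ (Fin 2) → M} {rlo rhi : ℝ}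
    (hs : ContMDiffOn (𝓡 2) (𝓡 4) ∞ ψ {x | rlo < ‖x‖ ∧ ‖x‖ < rhi})
    (hinj : InjOn ψ {x | rlo < ‖x‖ ∧ ‖x‖ < rhi})
    (himm : ∀ x : EuclideanSpace ℝ (Fin 2), rlo < ‖x‖ → ‖x‖ < rhi →
      Injective (mfderiv (𝓡 2) (𝓡 4) ψ x))
    {c : ℝ} (hc : 0 < c) (hlo : rlo < c) (hhi : c < rhi) :
    Manifold.IsSmoothEmbedding (𝓡 1) (𝓡 4) ∞
      (fun x : sphere (0 : EuclideanSpace ℝ (Fin (1 + 1))) 1 =>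
        ψ (c • (x : EuclideanSpace ℝ (Fin 2)))) := by
  haveI : Fact (finrank ℝ (EuclideanSpace ℝ (Fin (1 + 1))) = 1 + 1) := ⟨finrank_euclideanSpace_fin⟩
  set A : Set (EuclideanSpace ℝ (Fin 2)) := {x | rlo < ‖x‖ ∧ ‖x‖ < rhi} with hA_def
  have hA : IsOpen A :=
    (isOpen_lt continuous_const continuous_norm).inter (isOpen_lt continuous_norm continuous_const)
  set L : EuclideanSpace ℝ (Fin 2) ≃L[ℝ] EuclideanSpace ℝ (Fin 2) :=
    ContinuousLinearEquiv.smulLeft (Units.mk0 c hc.ne') with hL_def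
  have hL : ∀ y : EuclideanSpace ℝ (Fin 2), L y = c • y := fun y => by
    rw [hL_def, ContinuousLinearEquiv.smulLeft_apply_apply, Units.smul_mk0]
  have hcoe : ContMDiff (𝓡 1) (𝓡 2) ∞
      ((↑) : sphere (0 : EuclideanSpace ℝ (Fin (1 + 1))) 1 → EuclideanSpace ℝ (Fin 2)) :=
    contMDiff_coe_sphere
  have hLc : ContMDiff (𝓡 2) (𝓡 2) ∞ (L : EuclideanSpace ℝ (Fin 2) → EuclideanSpace ℝ (Fin 2)) :=
    (L : EuclideanSpace ℝ (Fin 2) →L[ℝ] EuclideanSpace ℝ (Fin 2)).contMDiff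
  -- the circle of radius `c` lies in the annulus
  have hmemA : ∀ x : sphere (0 : EuclideanSpace ℝ (Fin (1 + 1))) 1,
      L (x : EuclideanSpace ℝ (Fin 2)) ∈ A := fun x => by
    rw [hL, hA_def, mem_setOf_eq, norm_smul, Real.norm_of_nonneg hc.le, norm_eq_of_mem_sphere x,
      mul_one]
    exact ⟨hlo, hhi⟩
  have heq : (fun x : sphere (0 : EuclideanSpace ℝ (Fin (1 + 1))) 1 =>
      ψ (c • (x : EuclideanSpace ℝ (Fin 2)))) = ψ ∘ (L ∘ (↑)) := by
    funext x
    simp only [Function.comp_apply, hL]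
  rw [heq]
  have hc' : ContMDiff (𝓡 1) (𝓡 4) ∞ (ψ ∘ (L ∘ (↑)) :
      sphere (0 : EuclideanSpace ℝ (Fin (1 + 1))) 1 → M) :=
    hs.comp_contMDiff (hLc.comp hcoe) hmemA
  refine isSmoothEmbedding_of_injective_of_injective_mfderiv hc' (by exact_mod_cast le_top)
    (fun x y hxy => Subtype.val_injective (L.injective (hinj (hmemA x) (hmemA y) hxy)))
    fun x => ?_
  have h1 : MDifferentiableAt (𝓡 1) (𝓡 2)
      ((↑) : sphere (0 : EuclideanSpace ℝ (Fin (1 + 1))) 1 → EuclideanSpace ℝ (Fin 2)) x :=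
    (hcoe x).mdifferentiableAt (by simp)
  have h2 : MDifferentiableAt (𝓡 2) (𝓡 2) (L : EuclideanSpace ℝ (Fin 2) → EuclideanSpace ℝ (Fin 2))
      (x : EuclideanSpace ℝ (Fin 2)) := (hLc _).mdifferentiableAt (by simp)
  have h12 : MDifferentiableAt (𝓡 1) (𝓡 2)
      (L ∘ (↑) : sphere (0 : EuclideanSpace ℝ (Fin (1 + 1))) 1 → EuclideanSpace ℝ (Fin 2)) x :=
    h2.comp x h1
  have h3 : MDifferentiableAt (𝓡 2) (𝓡 4) ψ (L (x : EuclideanSpace ℝ (Fin 2))) :=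
    ((hs _ (hmemA x)).contMDiffAt (hA.mem_nhds (hmemA x))).mdifferentiableAt (by simp)
  rw [mfderiv_comp x h3 h12, mfderiv_comp x h2 h1, ContinuousLinearEquiv.mfderiv_eq]
  have hinjψ : Injective (mfderiv (𝓡 2) (𝓡 4) ψ (L (x : EuclideanSpace ℝ (Fin 2)))) :=
    himm _ (hmemA x).1 (hmemA x).2
  exact hinjψ.comp (L.injective.comp (mfderiv_coe_sphere_injective (n := 1) x))

/-- **REGISTERED helper (line `Sketch`): every round circle of an annular chart of the central
surface is a curve of it** (`Trisection.IsCurve T`): for a plane map `ψ` smooth, injective and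
immersive into `M` on the open annulus `{rlo < ‖x‖ < rhi}` with image inside
`centralSurfaceSet T`, and any radius `rlo < r < rhi`, `0 < r`, the circle `ψ(r · S¹)` lies in the
central surface and is the image of the smooth embedding `x ↦ ψ (r • x)`. [folklore] -/
theorem helper_isCurve_roundCircle_of_annularChart :
    ∀ (M : Type) [TopologicalSpace M] [T2Space M] [SecondCountableTopology M]
      [ChartedSpace (EuclideanSpace ℝ (Fin 4)) M] [IsManifold (𝓡 4) ∞ M]
      (T : Fin 3 → Set M) (ψ : EuclideanSpace ℝ (Fin 2) → M) (rlo rhi : ℝ),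
      ContMDiffOn (𝓡 2) (𝓡 4) ∞ ψ {x | rlo < ‖x‖ ∧ ‖x‖ < rhi} →
      Set.InjOn ψ {x | rlo < ‖x‖ ∧ ‖x‖ < rhi} →
      (∀ x : EuclideanSpace ℝ (Fin 2), rlo < ‖x‖ → ‖x‖ < rhi →
        Function.Injective (mfderiv (𝓡 2) (𝓡 4) ψ x)) →
      ψ '' {x | rlo < ‖x‖ ∧ ‖x‖ < rhi} ⊆ centralSurfaceSet T →
      ∀ r : ℝ, 0 < r → rlo < r → r < rhi →
      IsCurve T (Set.range fun x : Metric.sphere (0 : EuclideanSpace ℝ (Fin 2)) 1 =>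
        ψ (r • (x : EuclideanSpace ℝ (Fin 2)))) := by
  intro M _ _ _ _ _ T ψ rlo rhi hs hinj himm hF r hr hlo hhi
  refine ⟨?_, fun x => ψ (r • (x : EuclideanSpace ℝ (Fin 2))),
    isSmoothEmbedding_comp_smul_sphere_of_annularChart hs hinj himm hr hlo hhi, rfl⟩
  rintro _ ⟨x, rfl⟩
  refine hF ⟨r • (x : EuclideanSpace ℝ (Fin 2)), ?_, rfl⟩
  rw [mem_setOf_eq, norm_smul, Real.norm_of_nonneg hr.le, norm_eq_of_mem_sphere x, mul_one]
  exact ⟨hlo, hhi⟩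

end Summit.SmoothPoincare4.SmoothPoincare4.Theorems

end
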